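import Summits.BirchSwinnertonDyer.BirchSwinnertonDyer.Theorems.CountingDoorF2AtThreeMemberwiseGenericity
import Summits.BirchSwinnertonDyer.BirchSwinnertonDyer.Theorems.CountingDoorF2AtThreeSelmerNineLevers
import HarnessLib

/-!
# BirchSwinnertonDyer / CountingDoorF2AtThree — the REFINED door family `Φ*** = Φ** ∩ {a ≡ a* (13)}`:
# a large congruence subfamily of `F₂` on which GENERIC MEMBERS (`E(ℚ)_tors = 0 ∧ rank ≥ 2`), the
# local door conditions and Schneider non-degeneracy at `3` all hold for EVERY member — and the
# route's chains WITHOUT the fact pack `LargeFamilyInputsF2`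

Cell bsd-rank2, seat bsd-rank2-eng-2 GEN 3; BY-NAME levers `--supports` crux I1 `SelmerThreeAverageLargeF2`
(stmt-BirchSwinnertonDyer-19440) of `route-BirchSwinnertonDyer-CountingDoorF2AtThree`.

* §1 `exists_sieveClassFamily₁₃` — the sieve-class construction of `Theorems.exists_sieveClassFamily`
  with ONE more class condition `a ≡ r (mod 13)` (and the square-free sieve `ℓ² ∤ Δ(a)` at every
  `ℓ ∉ {3,5,7,13}`); membership CHARACTERISED by congruences; large by definition (`p₀ = 14`).
* §2 `exists_refinedDoorFamily` — the instance of record `r = a* = (−524, 450, −374, 3825)` (classes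
  `(7,0,4,0) mod 9`, `(1,0,1,0) mod 25`, `(1,2,4,3) mod 7`, `(9,8,3,3) mod 13`): a large family with
  nonempty residue sets and a member, contained in the sieve-class family `Φ**` of I4loc's line of
  record, such that EVERY member has (i) the local door conditions of `Theorems.leaf_of_local`
  (from `Φ**`), (ii) `torsionOrder = 1 ∧ 2 ≤ rank` (`params_torsionOrder_eq_one_and_two_le_rank_of_classes`,
  companion file), (iii) Schneider non-degeneracy of every canonical `3`-adic height datum on every
  globally minimal good-ordinary rank-two model (I4loc's landed member-wise certificate
  `params_heightDigits_of_class` + `stub_transport` + `schneiderConjecture_of_nonresidue_digits`); hence the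
  two `100 %` inputs `hGen`, `hSchD` of the Φ-local bridges are THEOREMS on this family.
* §3 The route's chains re-run on `Φ***` with `LargeFamilyInputsF2` (item 19549, Bhargava–Ho Thm 9.1/10.1)
  NO LONGER A HYPOTHESIS: `leaf_of_cruxes_without_largeFamilyInputs :
  PublishedInputsAtThree → SelmerThreeAverageLargeF2 → RootNumberPlusLowerDensityLargeF2 →
  PAdicBSDRankTwoPositiveProportion` (the Assembly's statement minus `LargeFamilyInputsF2` and minus the
  discharged I4); the capped and D9 forms `…_of_cappedAverage_refined`, `…_of_selmerNineDensity_refined`;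
  and the FACT-FREE weak leaf `weakLeaf_of_selmerNineDensity_refined` (D9 on the refined family ⇒
  `rank = 2 ∧ Ш[3^∞] = 0` with positive lower density — no published input at all).

THEOREMS ONLY (no definition, no named fact, no `sorry`). PARTITION: none — r_an ≥ 2, summit axis S0
(D-0036(1) funded rung); TWIN (D-0056): n/a. B1 honesty: bookkeeping on an explicit congruence family;
the open family-wise inputs (I1 `3`-Selmer average, I2 root-number density, or D9) are hypotheses; nothing
reads an analytic rank; no S0 motion.

References: M. Bhargava, W. Ho, arXiv:2207.03309 §1, Thm. 9.1/10.1 [BhargavaHo2022]; M. Bhargava,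
A. Shankar, Ann. of Math. 181 (2015) §1 [BhargavaShankarTernary2015]; J. H. Silverman, *AEC* (2009)
VII.3.1(b), VIII.6.7 [SilvermanAEC2009]; Mazur–Stein–Tate 2006 §1 [MazurSteinTate2006].
-/

set_option linter.dupNamespace false

noncomputable section

open scoped Classical
open Filter Topology
open WeierstrassCurve Literature.NumberTheory.EllipticCurves
  Literature.NumberTheory.EllipticCurves.BhargavaHo2022
  Summit.BirchSwinnertonDyer.Rank2
  Summit.BirchSwinnertonDyer.BirchSwinnertonDyer.Theses.CountingDoorF2AtThree

namespace Summit.BirchSwinnertonDyer.BirchSwinnertonDyer.Theorems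

/-! ### §1 The sieve-class family with a class at `13` -/

/-- **The sieve-class family of a representative `r`, with a class at `13`.** For a member `r` of `F₂`
with `ℓ² ∤ Δ(r)` at every prime there is a subfamily `Φ` of `F₂` defined by congruence conditions —
`a ≡ r (mod 9)`, `a ≡ r (mod 25)`, `a ≡ r (mod 7)`, `a ≡ r (mod 13)`, and `ℓ² ∤ Δ(a)` at every other
prime `ℓ` — which is large (no member with `ℓ² ∤ Δ` is excluded at `ℓ ≥ 14`), has nonempty residue
sets, has the member `r`, and whose membership is CHARACTERISED by these congruences (the construction of
`Theorems.exists_sieveClassFamily` with one more class). [cite: BhargavaHo2022, §1 (large subfamilies defined by congruence conditions)] -/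
theorem exists_sieveClassFamily₁₃ (r : Params) (hr : r.IsMember)
    (hsq : ∀ ℓ : ℕ, ℓ.Prime → ¬ ((ℓ : ℤ) ^ 2 ∣ r.curveInt.Δ)) :
    ∃ Φ : CongruenceFamily₂, Φ.IsLarge ∧ (∀ p : ℕ, p.Prime → (Φ.residues p).Nonempty) ∧ Φ.Mem r ∧
      (∀ a : Params, Φ.Mem a ↔ a.IsMember ∧
        ((a.a₁ : ZMod (3 ^ 2)) = r.a₁ ∧ (a.a₂ : ZMod (3 ^ 2)) = r.a₂ ∧
          (a.a₂' : ZMod (3 ^ 2)) = r.a₂' ∧ (a.a₃ : ZMod (3 ^ 2)) = r.a₃) ∧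
        ((a.a₁ : ZMod (5 ^ 2)) = r.a₁ ∧ (a.a₂ : ZMod (5 ^ 2)) = r.a₂ ∧
          (a.a₂' : ZMod (5 ^ 2)) = r.a₂' ∧ (a.a₃ : ZMod (5 ^ 2)) = r.a₃) ∧
        ((a.a₁ : ZMod 7) = r.a₁ ∧ (a.a₂ : ZMod 7) = r.a₂ ∧
          (a.a₂' : ZMod 7) = r.a₂' ∧ (a.a₃ : ZMod 7) = r.a₃) ∧
        ((a.a₁ : ZMod 13) = r.a₁ ∧ (a.a₂ : ZMod 13) = r.a₂ ∧
          (a.a₂' : ZMod 13) = r.a₂' ∧ (a.a₃ : ZMod 13) = r.a₃) ∧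
        ∀ ℓ : ℕ, ℓ.Prime → ℓ ≠ 3 → ℓ ≠ 5 → ℓ ≠ 7 → ℓ ≠ 13 → ¬ ((ℓ : ℤ) ^ 2 ∣ a.curveInt.Δ)) := by
  -- the family, remembered only through the unfolding of its residue conditions
  obtain ⟨Φ, hΦ⟩ : ∃ Φ : CongruenceFamily₂, ∀ (p : ℕ) (a : Params),
      Φ.residueOf p a ∈ Φ.residues p ↔ ∃ b : Params,
        ((b.a₁ : ZMod (p ^ 2)) = a.a₁ ∧ (b.a₂ : ZMod (p ^ 2)) = a.a₂ ∧
          (b.a₂' : ZMod (p ^ 2)) = a.a₂' ∧ (b.a₃ : ZMod (p ^ 2)) = a.a₃) ∧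
        ((p = 3 ∨ p = 5) → (b.a₁ : ZMod (p ^ 2)) = r.a₁ ∧ (b.a₂ : ZMod (p ^ 2)) = r.a₂ ∧
          (b.a₂' : ZMod (p ^ 2)) = r.a₂' ∧ (b.a₃ : ZMod (p ^ 2)) = r.a₃) ∧
        ((p = 7 ∨ p = 13) → (b.a₁ : ZMod p) = r.a₁ ∧ (b.a₂ : ZMod p) = r.a₂ ∧
          (b.a₂' : ZMod p) = r.a₂' ∧ (b.a₃ : ZMod p) = r.a₃) ∧
        ((p ≠ 3 ∧ p ≠ 5 ∧ p ≠ 7 ∧ p ≠ 13) → ¬ ((p : ℤ) ^ 2 ∣ b.curveInt.Δ)) :=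
    ⟨⟨fun _ ↦ 2, fun p ↦ {ρ | ∃ b : Params,
        ((b.a₁ : ZMod (p ^ 2)) = ρ.1 ∧ (b.a₂ : ZMod (p ^ 2)) = ρ.2.1 ∧
          (b.a₂' : ZMod (p ^ 2)) = ρ.2.2.1 ∧ (b.a₃ : ZMod (p ^ 2)) = ρ.2.2.2) ∧
        ((p = 3 ∨ p = 5) → (b.a₁ : ZMod (p ^ 2)) = r.a₁ ∧ (b.a₂ : ZMod (p ^ 2)) = r.a₂ ∧
          (b.a₂' : ZMod (p ^ 2)) = r.a₂' ∧ (b.a₃ : ZMod (p ^ 2)) = r.a₃) ∧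
        ((p = 7 ∨ p = 13) → (b.a₁ : ZMod p) = r.a₁ ∧ (b.a₂ : ZMod p) = r.a₂ ∧
          (b.a₂' : ZMod p) = r.a₂' ∧ (b.a₃ : ZMod p) = r.a₃) ∧
        ((p ≠ 3 ∧ p ≠ 5 ∧ p ≠ 7 ∧ p ≠ 13) → ¬ ((p : ℤ) ^ 2 ∣ b.curveInt.Δ))}⟩,
      fun _ _ ↦ Iff.rfl⟩
  -- membership characterisation
  have key : ∀ a : Params, Φ.Mem a ↔ a.IsMember ∧
      ((a.a₁ : ZMod (3 ^ 2)) = r.a₁ ∧ (a.a₂ : ZMod (3 ^ 2)) = r.a₂ ∧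
        (a.a₂' : ZMod (3 ^ 2)) = r.a₂' ∧ (a.a₃ : ZMod (3 ^ 2)) = r.a₃) ∧
      ((a.a₁ : ZMod (5 ^ 2)) = r.a₁ ∧ (a.a₂ : ZMod (5 ^ 2)) = r.a₂ ∧
        (a.a₂' : ZMod (5 ^ 2)) = r.a₂' ∧ (a.a₃ : ZMod (5 ^ 2)) = r.a₃) ∧
      ((a.a₁ : ZMod 7) = r.a₁ ∧ (a.a₂ : ZMod 7) = r.a₂ ∧
        (a.a₂' : ZMod 7) = r.a₂' ∧ (a.a₃ : ZMod 7) = r.a₃) ∧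
      ((a.a₁ : ZMod 13) = r.a₁ ∧ (a.a₂ : ZMod 13) = r.a₂ ∧
        (a.a₂' : ZMod 13) = r.a₂' ∧ (a.a₃ : ZMod 13) = r.a₃) ∧
      ∀ ℓ : ℕ, ℓ.Prime → ℓ ≠ 3 → ℓ ≠ 5 → ℓ ≠ 7 → ℓ ≠ 13 → ¬ ((ℓ : ℤ) ^ 2 ∣ a.curveInt.Δ) := by
    intro a
    constructor
    · rintro ⟨ha, hres⟩
      obtain ⟨b₃, ⟨e₁, e₂, e₂', e₃⟩, hc₃, -, -⟩ := (hΦ 3 a).mp (hres 3 Nat.prime_three)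
      obtain ⟨f₁, f₂, f₂', f₃⟩ := hc₃ (Or.inl rfl)
      obtain ⟨b₅, ⟨g₁, g₂, g₂', g₃⟩, hc₅, -, -⟩ := (hΦ 5 a).mp (hres 5 (by norm_num))
      obtain ⟨k₁, k₂, k₂', k₃⟩ := hc₅ (Or.inr rfl)
      obtain ⟨b₇, ⟨m₁, m₂, m₂', m₃⟩, -, hc₇, -⟩ := (hΦ 7 a).mp (hres 7 (by norm_num))
      obtain ⟨n₁, n₂, n₂', n₃⟩ := hc₇ (Or.inl rfl)
      obtain ⟨b₁₃, ⟨u₁, u₂, u₂', u₃⟩, -, hc₁₃, -⟩ := (hΦ 13 a).mp (hres 13 (by norm_num))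
      obtain ⟨v₁, v₂, v₂', v₃⟩ := hc₁₃ (Or.inr rfl)
      refine ⟨ha, ⟨e₁ ▸ f₁, e₂ ▸ f₂, e₂' ▸ f₂', e₃ ▸ f₃⟩, ⟨g₁ ▸ k₁, g₂ ▸ k₂, g₂' ▸ k₂', g₃ ▸ k₃⟩,
        ⟨?_, ?_, ?_, ?_⟩, ⟨?_, ?_, ?_, ?_⟩, ?_⟩
      · rw [← intCast_zmod_eq_of_sq (p := 7) m₁]; exact n₁
      · rw [← intCast_zmod_eq_of_sq (p := 7) m₂]; exact n₂
      · rw [← intCast_zmod_eq_of_sq (p := 7) m₂']; exact n₂'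
      · rw [← intCast_zmod_eq_of_sq (p := 7) m₃]; exact n₃
      · rw [← intCast_zmod_eq_of_sq (p := 13) u₁]; exact v₁
      · rw [← intCast_zmod_eq_of_sq (p := 13) u₂]; exact v₂
      · rw [← intCast_zmod_eq_of_sq (p := 13) u₂']; exact v₂'
      · rw [← intCast_zmod_eq_of_sq (p := 13) u₃]; exact v₃
      · intro ℓ hℓ h3 h5 h7 h13 hdvd
        obtain ⟨b, ⟨o₁, o₂, o₂', o₃⟩, -, -, hcs⟩ := (hΦ ℓ a).mp (hres ℓ hℓ)
        refine hcs ⟨h3, h5, h7, h13⟩ ?_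
        have hiff := F2Member.dvd_Δ_iff_of_cast_eq (n := ℓ ^ 2) o₁ o₂ o₂' o₃
        push_cast at hiff
        exact hiff.mpr hdvd
    · rintro ⟨ha, ⟨f₁, f₂, f₂', f₃⟩, ⟨k₁, k₂, k₂', k₃⟩, ⟨n₁, n₂, n₂', n₃⟩, ⟨v₁, v₂, v₂', v₃⟩, hsieve⟩
      refine ⟨ha, fun p hp ↦ (hΦ p a).mpr ⟨a, ⟨rfl, rfl, rfl, rfl⟩, ?_, ?_, ?_⟩⟩
      · rintro (rfl | rfl)
        · exact ⟨f₁, f₂, f₂', f₃⟩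
        · exact ⟨k₁, k₂, k₂', k₃⟩
      · rintro (rfl | rfl)
        · exact ⟨n₁, n₂, n₂', n₃⟩
        · exact ⟨v₁, v₂, v₂', v₃⟩
      · rintro ⟨h3, h5, h7, h13⟩
        exact hsieve p hp h3 h5 h7 h13
  -- `r` is a member of `Φ`
  have hrMem : Φ.Mem r :=
    (key r).mpr ⟨hr, ⟨rfl, rfl, rfl, rfl⟩, ⟨rfl, rfl, rfl, rfl⟩, ⟨rfl, rfl, rfl, rfl⟩,
      ⟨rfl, rfl, rfl, rfl⟩, fun ℓ hℓ _ _ _ _ ↦ hsq ℓ hℓ⟩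
  refine ⟨Φ, ?_, fun p hp ↦ ⟨_, hrMem.2 p hp⟩, hrMem, key⟩
  -- large at every prime `p ≥ 14`: there the condition IS `p² ∤ Δ`
  refine ⟨14, fun p h14 _ a _ hnd ↦ (hΦ p a).mpr ⟨a, ⟨rfl, rfl, rfl, rfl⟩, ?_, ?_, fun _ ↦ hnd⟩⟩
  · rintro (rfl | rfl) <;> omega
  · rintro (rfl | rfl) <;> omega

/-! ### §2 The refined door family of record: `r = a* = (−524, 450, −374, 3825)` -/

/-- **The refined door family `Φ***`.** There is a large subfamily of `F₂` defined by congruence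
conditions (`a ≡ (7,0,4,0) mod 9`, `(1,0,1,0) mod 25`, `(1,2,4,3) mod 7`, `(9,8,3,3) mod 13`,
`ℓ² ∤ Δ(a)` elsewhere), with nonempty residue sets and the member `a* = (−524, 450, −374, 3825)`, ALL of
whose members have: the local door conditions of `leaf_of_local` (irreducible `ρ̄₃`; every globally
minimal model good ordinary at `3` with an auxiliary multiplicative prime `ℓ ≠ 3`, `3 ∤ ord_ℓ Δ_min`);
the square-free sieve `ℓ² ∤ Δ(a)` at every prime; trivial rational torsion and `rank ≥ 2`
(`params_torsionOrder_eq_one_and_two_le_rank_of_classes`); and Schneider non-degeneracy at `3` of every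
canonical height datum on every globally minimal good-ordinary model of rank `2` (I4loc's member-wise
certificate). [cite: BhargavaHo2022, §1 (large subfamilies defined by congruence conditions)]
[cite: MazurSteinTate2006, §1 eq. (1.1) and Thm. 1.3] [cite: SilvermanAEC2009, Prop. VII.3.1(b) and Thm. VIII.6.7] -/
theorem exists_refinedDoorFamily :
    ∃ Φ : CongruenceFamily₂, Φ.IsLarge ∧ (∀ p : ℕ, p.Prime → (Φ.residues p).Nonempty) ∧
      Φ.Mem ⟨-524, 450, -374, 3825⟩ ∧
      (∀ a : Params, Φ.Mem a →
        (a.curve.HasIrreducibleModPGaloisRep 3 ∧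
          ∀ (C : VariableChange ℚ) (hC : (C • a.curve).IsGloballyMinimal),
            @IsOrdinaryAt (C • a.curve) hC 3 _ ∧ ∃ ℓ : ℕ, ∃ _ : Fact ℓ.Prime, ℓ ≠ 3 ∧
              (C • a.curve).HasMultiplicativeReductionAtPrime ℓ ∧
              ¬ 3 ∣ padicValInt ℓ (@minimalDiscriminantInt (C • a.curve) hC)) ∧
        (∀ ℓ : ℕ, ℓ.Prime → ¬ ((ℓ : ℤ) ^ 2 ∣ a.curveInt.Δ)) ∧
        (a.curve.torsionOrder = 1 ∧ 2 ≤ a.curve.mordellWeilRank) ∧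
        (∀ (C : VariableChange ℚ) (hC : (C • a.curve).IsGloballyMinimal),
          @IsOrdinaryAt (C • a.curve) hC 3 _ → (C • a.curve).mordellWeilRank = 2 →
            ∀ Dh : PAdicHeightData (C • a.curve) 3, Dh.IsCanonical → SchneiderConjecture Dh)) := by
  -- the refined family and the sieve-class family of record
  obtain ⟨Φ, hL, hne, hmem, key⟩ := exists_sieveClassFamily₁₃ ⟨-524, 450, -374, 3825⟩
    (fun h0 ↦ not_squarefree_zero (h0 ▸ squarefree_Δ_repStar))
    (not_sq_dvd_of_squarefree squarefree_Δ_repStar)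
  obtain ⟨Ψ, -, -, -, keyΨ, hlocΨ⟩ := exists_sieveClassFamily_star
  -- the representative's residues, as numerals
  have h9₁ : (((⟨-524, 450, -374, 3825⟩ : Params).a₁ : ℤ) : ZMod (3 ^ 2)) = 7 := by decide
  have h9₂ : (((⟨-524, 450, -374, 3825⟩ : Params).a₂ : ℤ) : ZMod (3 ^ 2)) = 0 := by decide
  have h9₂' : (((⟨-524, 450, -374, 3825⟩ : Params).a₂' : ℤ) : ZMod (3 ^ 2)) = 4 := by decide
  have h9₃ : (((⟨-524, 450, -374, 3825⟩ : Params).a₃ : ℤ) : ZMod (3 ^ 2)) = 0 := by decide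
  have h25₁ : (((⟨-524, 450, -374, 3825⟩ : Params).a₁ : ℤ) : ZMod (5 ^ 2)) = 1 := by decide
  have h25₂ : (((⟨-524, 450, -374, 3825⟩ : Params).a₂ : ℤ) : ZMod (5 ^ 2)) = 0 := by decide
  have h25₂' : (((⟨-524, 450, -374, 3825⟩ : Params).a₂' : ℤ) : ZMod (5 ^ 2)) = 1 := by decide
  have h25₃ : (((⟨-524, 450, -374, 3825⟩ : Params).a₃ : ℤ) : ZMod (5 ^ 2)) = 0 := by decide
  have h7₁ : (((⟨-524, 450, -374, 3825⟩ : Params).a₁ : ℤ) : ZMod 7) = 1 := by decide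
  have h7₂ : (((⟨-524, 450, -374, 3825⟩ : Params).a₂ : ℤ) : ZMod 7) = 2 := by decide
  have h7₂' : (((⟨-524, 450, -374, 3825⟩ : Params).a₂' : ℤ) : ZMod 7) = 4 := by decide
  have h7₃ : (((⟨-524, 450, -374, 3825⟩ : Params).a₃ : ℤ) : ZMod 7) = 3 := by decide
  have h13₁ : (((⟨-524, 450, -374, 3825⟩ : Params).a₁ : ℤ) : ZMod 13) = 9 := by decide
  have h13₂ : (((⟨-524, 450, -374, 3825⟩ : Params).a₂ : ℤ) : ZMod 13) = 8 := by decide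
  have h13₂' : (((⟨-524, 450, -374, 3825⟩ : Params).a₂' : ℤ) : ZMod 13) = 3 := by decide
  have h13₃ : (((⟨-524, 450, -374, 3825⟩ : Params).a₃ : ℤ) : ZMod 13) = 3 := by decide
  refine ⟨Φ, hL, hne, hmem, fun a ha ↦ ?_⟩
  obtain ⟨haM, h9, h25, h7, ⟨t₁, t₂, t₂', t₃⟩, hsieve⟩ := (key a).mp ha
  rw [h13₁] at t₁; rw [h13₂] at t₂; rw [h13₂'] at t₂'; rw [h13₃] at t₃
  -- `a ∈ Φ**`: at `13` the class gives `13 ∤ Δ(a)`, hence `13² ∤ Δ(a)`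
  have h13Δ : ¬ ((13 : ℤ) ∣ a.curveInt.Δ) := params_not_thirteen_dvd_Δ_of_class a t₁ t₂ t₂' t₃
  have haΨ : Ψ.Mem a := by
    refine (keyΨ a).mpr ⟨haM, ?_, ?_, ?_, fun ℓ hℓ h3 h5 h7' ↦ ?_⟩
    · rw [h9₁, h9₂, h9₂', h9₃] at h9; exact h9
    · rw [h25₁, h25₂, h25₂', h25₃] at h25; exact h25
    · rw [h7₁, h7₂, h7₂', h7₃] at h7; exact h7
    · by_cases h13 : ℓ = 13
      · subst h13
        exact fun h ↦ h13Δ (dvd_trans (dvd_pow_self _ two_ne_zero) (by exact_mod_cast h))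
      · exact hsieve ℓ hℓ h3 h5 h7' h13
  obtain ⟨hloc, hsq, ⟨c₁, c₂, c₂', c₃⟩⟩ := hlocΨ a haΨ
  -- the classes modulo `9` and `7`, as numerals
  rw [h9₁, h9₂, h9₂', h9₃] at h9
  rw [h7₁, h7₂, h7₂', h7₃] at h7
  obtain ⟨n₁, n₂, n₂', n₃⟩ := h9
  obtain ⟨s₁, s₂, s₂', s₃⟩ := h7
  refine ⟨hloc, hsq, params_torsionOrder_eq_one_and_two_le_rank_of_classes a haM c₁ c₂ c₂' c₃
    s₁ s₂ s₂' s₃ t₁ t₂ t₂' t₃, ?_⟩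
  -- Schneider at `3`, member-wise: I4loc's digit certificate `(1, 2)` and the model transport
  haveI : a.curve.IsElliptic := Params.isElliptic_curve haM
  refine CountingDoorF2AtThreeSchneiderOnDoorSubfamilyStubTransport.stub_transport a haM hsq ?_
  intro Dh hDh hrank
  obtain ⟨dA, dB, h2, hA, hB, hC⟩ := params_heightDigits_of_class a haM hsq
    (by exact_mod_cast n₁) (by exact_mod_cast n₂) (by exact_mod_cast n₂') (by exact_mod_cast n₃)
    (params_ψ_two_markedPoint₁_zmod_seven a s₁ s₂ s₃).2 Dh hDh
  exact schneiderConjecture_of_nonresidue_digits Dh _ _ 2 3 hA hB hC h2 hrank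

/-! ### §3 The route's chains on the refined family — `LargeFamilyInputsF2` is no longer a hypothesis -/

/-- **The refined door family with its two `100 %` inputs as theorems**: a large `Φ ⊆ F₂` with
nonempty residue sets and the member-wise local door conditions, on which `torsionOrder = 1 ∧
rank ≥ 2` and Schneider non-degeneracy at `3` (on every globally minimal good-ordinary rank-two model)
hold with density ONE — indeed for every member (`exists_refinedDoorFamily` and
`stub_hasDensityOn_one_of_forall`). [cite: BhargavaHo2022, §1 (large subfamilies defined by congruence conditions)] -/
theorem exists_refinedDoorFamily_densities :
    ∃ Φ : CongruenceFamily₂, Φ.IsLarge ∧ (∀ p : ℕ, p.Prime → (Φ.residues p).Nonempty) ∧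
      (∀ a : Params, Φ.Mem a → a.curve.HasIrreducibleModPGaloisRep 3 ∧
        ∀ (C : VariableChange ℚ) (hC : (C • a.curve).IsGloballyMinimal),
          @IsOrdinaryAt (C • a.curve) hC 3 _ ∧ ∃ ℓ : ℕ, ∃ _ : Fact ℓ.Prime, ℓ ≠ 3 ∧
            (C • a.curve).HasMultiplicativeReductionAtPrime ℓ ∧
            ¬ 3 ∣ padicValInt ℓ (@minimalDiscriminantInt (C • a.curve) hC)) ∧
      Φ.HasDensityOn (fun a ↦ a.curve.torsionOrder = 1 ∧ 2 ≤ a.curve.mordellWeilRank) 1 ∧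
      Φ.HasDensityOn (fun a ↦ ∀ (C : WeierstrassCurve.VariableChange ℚ)
        (hC : (C • a.curve).IsGloballyMinimal), @IsOrdinaryAt (C • a.curve) hC 3 _ →
        (C • a.curve).mordellWeilRank = 2 → ∀ Dh : PAdicHeightData (C • a.curve) 3, Dh.IsCanonical →
        SchneiderConjecture Dh) 1 := by
  obtain ⟨Φ, hL, hne, hmem, hall⟩ := exists_refinedDoorFamily
  exact ⟨Φ, hL, hne, fun a ha ↦ (hall a ha).1,
    CountingDoorF2AtThreeSchneiderOnDoorSubfamilyStubHasDensityOnOneOfForall.stub_hasDensityOn_one_of_forall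
      Φ _ ⟨_, hmem⟩ fun a ha ↦ (hall a ha).2.2.1,
    CountingDoorF2AtThreeSchneiderOnDoorSubfamilyStubHasDensityOnOneOfForall.stub_hasDensityOn_one_of_forall
      Φ _ ⟨_, hmem⟩ fun a ha ↦ (hall a ha).2.2.2⟩

/-- **The leaf from the published inputs at `3`, I1 and I2 ALONE** — the statement of the route's
`Assembly` with the fact pack `LargeFamilyInputsF2` (Bhargava–Ho Thm 9.1/10.1) and the discharged I4
REMOVED: on the refined door family the generic-members input is a theorem (reduction mod `3·7·13`), the
Schneider input is I4loc's member-wise certificate, and the first-moment door `Theorems.leaf_of_local` runs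
with `A = 36` (I1) and `ρ > 1/6` (I2), `36 < 27 + 54ρ`. [cite: BhargavaShankarTernary2015, §1 (first-moment method with parity)]
[cite: BhargavaHo2022, Thm. 1.3 (shape: positive proportion)] -/
theorem leaf_of_cruxes_without_largeFamilyInputs (hIn : PublishedInputsAtThree)
    (h1 : SelmerThreeAverageLargeF2) (h2 : RootNumberPlusLowerDensityLargeF2) :
    PAdicBSDRankTwoPositiveProportion := by
  obtain ⟨Φ, hL, hne, hloc, hGen, hSchD⟩ := exists_refinedDoorFamily_densities
  obtain ⟨ρ, hρ6, hW⟩ := h2 Φ hL hne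
  exact leaf_of_local Φ hL hloc hIn (hasDensityOn_one_mono Φ hGen fun _ h ↦ h.2) (h1 Φ hL) hW
    (by linarith) (by linarith) hSchD

/-- **The leaf from the published inputs at `3`, the CAPPED `3`-Selmer average (I1cap) and I2**, without
`LargeFamilyInputsF2` (`Theorems.leaf_of_local_capped` on the refined door family).
[cite: BhargavaShankarTernary2015, §1 (first-moment method with parity)] -/
theorem pAdicBSDRankTwoPositiveProportion_of_cappedAverage_refined (hIn : PublishedInputsAtThree)
    (h1 : ∀ Φ : CongruenceFamily₂, Φ.IsLarge →
      Φ.AverageOnLE (fun a ↦ min (Nat.card (a.curve.selmerGroup 3) : ℝ) 81) 36)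
    (h2 : RootNumberPlusLowerDensityLargeF2) : PAdicBSDRankTwoPositiveProportion := by
  obtain ⟨Φ, hL, hne, hloc, hGen, hSchD⟩ := exists_refinedDoorFamily_densities
  obtain ⟨ρ, hρ6, hW⟩ := h2 Φ hL hne
  exact leaf_of_local_capped Φ hL hloc hIn (hasDensityOn_one_mono Φ hGen fun _ h ↦ h.2) (h1 Φ hL) hW
    (by linarith) (by linarith) hSchD

/-- **D9 closes the leaf modulo the published inputs at `3` ONLY** (no `LargeFamilyInputsF2`): if in
every large subfamily of `F₂` with nonempty residue sets the members with `#Sel₃(E_a) = 9` have positive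
lower density, then `PAdicBSDRankTwoPositiveProportion` (`Theorems.leaf_of_local_selmerNine` on the refined
door family). [cite: BhargavaShankarTernary2015, §1 (positive proportion)] -/
theorem pAdicBSDRankTwoPositiveProportion_of_selmerNineDensity_refined (hIn : PublishedInputsAtThree)
    (hD9 : ∀ Φ : CongruenceFamily₂, Φ.IsLarge → (∀ p : ℕ, p.Prime → (Φ.residues p).Nonempty) →
      Φ.HasPositiveLowerDensityOn (fun a ↦ Nat.card (a.curve.selmerGroup 3) = 9)) :
    PAdicBSDRankTwoPositiveProportion := by
  obtain ⟨Φ, hL, hne, hloc, hGen, hSchD⟩ := exists_refinedDoorFamily_densities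
  exact leaf_of_local_selmerNine Φ hL hloc hIn (hasDensityOn_one_mono Φ hGen fun _ h ↦ h.2) hSchD
    (hD9 Φ hL hne)

/-- **The FACT-FREE weak leaf.** With NO published input at all (no `LargeFamilyInputsF2`, no parity,
no Mazur–Tate `σ`, no Schneider, no main conjecture): if in every large subfamily of `F₂` with nonempty
residue sets the members with `#Sel₃(E_a) = 9` have positive lower density (D9), then in some large
subfamily with nonempty residue sets — the refined door family — the members with `rank E_a(ℚ) = 2` and
`Ш(E_a)[3^∞] = 0` have positive lower density (pure counting, K1, on the member-wise generic family).
[folklore] -/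
theorem weakLeaf_of_selmerNineDensity_refined
    (hD9 : ∀ Φ : CongruenceFamily₂, Φ.IsLarge → (∀ p : ℕ, p.Prime → (Φ.residues p).Nonempty) →
      Φ.HasPositiveLowerDensityOn (fun a ↦ Nat.card (a.curve.selmerGroup 3) = 9)) :
    ∃ Φ : CongruenceFamily₂, Φ.IsLarge ∧ (∀ p : ℕ, p.Prime → (Φ.residues p).Nonempty) ∧
      Φ.HasPositiveLowerDensityOn (fun a ↦ a.IsMember ∧ a.curve.mordellWeilRank = 2 ∧
        AddCommGroup.primaryComponent a.curve.sha 3 = ⊥) := by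
  obtain ⟨Φ, hL, hne, -, hGen, -⟩ := exists_refinedDoorFamily_densities
  have hGood := hasDensityOn_rank_torsionBy_of_torsionOrder Φ 3 hGen
  have hD : Φ.HasPositiveLowerDensityOn (fun a ↦ Nat.card (a.curve.selmerGroup 3) = 3 ^ 2) :=
    hasPositiveLowerDensityOn_mono Φ (hD9 Φ hL hne) fun a h ↦ h.trans (by norm_num)
  exact ⟨Φ, hL, hne, hasPositiveLowerDensityOn_rank_two_sha_bot_of_card_selmerGroup_eq_sq Φ 3 hGood hD⟩

/-- **D9 contains the positivity half of I2 on the refined family, modulo `3`-parity only** (no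
`LargeFamilyInputsF2`): Dokchitser–Dokchitser `3`-parity and D9 give positive lower density of root
number `+1` in the refined door family. [cite: DokchitserDokchitserAnnals2010, Thm 1.4 (p-parity)] -/
theorem rootNumberPlusPositiveDensity_of_selmerNineDensity_refined
    (hDD : even_selmerRank_sub_torsionRank_iff)
    (hD9 : ∀ Φ : CongruenceFamily₂, Φ.IsLarge → (∀ p : ℕ, p.Prime → (Φ.residues p).Nonempty) →
      Φ.HasPositiveLowerDensityOn (fun a ↦ Nat.card (a.curve.selmerGroup 3) = 9)) :
    ∃ Φ : CongruenceFamily₂, Φ.IsLarge ∧ (∀ p : ℕ, p.Prime → (Φ.residues p).Nonempty) ∧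
      Φ.HasPositiveLowerDensityOn (fun a ↦ a.curve.rootNumber = 1) := by
  obtain ⟨Φ, hL, hne, -, hGen, -⟩ := exists_refinedDoorFamily_densities
  have hGood := hasDensityOn_rank_torsionBy_of_torsionOrder Φ 3 hGen
  have hD : Φ.HasPositiveLowerDensityOn (fun a ↦ Nat.card (a.curve.selmerGroup 3) = 3 ^ 2) :=
    hasPositiveLowerDensityOn_mono Φ (hD9 Φ hL hne) fun a h ↦ h.trans (by norm_num)
  exact ⟨Φ, hL, hne, hasPositiveLowerDensityOn_rootNumber_of_card_selmerGroup_eq_sq Φ 3 hDD hGood hD⟩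

/-! ### §4 The certified member of record -/

/-- **The certified member `a* = (−524, 450, −374, 3825)`** (eng-2 T12 §5; `Δ(a*) =
5·19·41·43·71·1129·1559·21503·652543`), i.e. the curve `y² − 524xy + 3825y = x³ − 174076x − 12790800`,
has trivial rational torsion and Mordell–Weil rank `≥ 2` — an instance of
`params_torsionOrder_eq_one_and_two_le_rank_of_classes` (`a* ≡ (1,0,1,0) mod 3`, `(1,2,4,3) mod 7`,
`(9,8,3,3) mod 13`). [cite: SilvermanAEC2009, Prop. VII.3.1(b) and Thm. VIII.6.7] -/
theorem torsionOrder_eq_one_and_two_le_rank_repStar :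
    (⟨-524, 450, -374, 3825⟩ : Params).curve.torsionOrder = 1 ∧
      2 ≤ (⟨-524, 450, -374, 3825⟩ : Params).curve.mordellWeilRank :=
  params_torsionOrder_eq_one_and_two_le_rank_of_classes _
    (fun h0 ↦ not_squarefree_zero (h0 ▸ squarefree_Δ_repStar))
    (by decide) (by decide) (by decide) (by decide) (by decide) (by decide) (by decide) (by decide)
    (by decide) (by decide) (by decide) (by decide)

end Summit.BirchSwinnertonDyer.BirchSwinnertonDyer.Theorems

end
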